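import Literature.NumberTheory.EllipticCurves.EisensteinSeriesTwoCharacterWeightTwoCusps
import Literature.NumberTheory.EllipticCurves.HeckeUOperatorLevelLowering
import Literature.NumberTheory.EllipticCurves.EisensteinNewformLevelRaisingIntegralFormLiftProofs
import Literature.NumberTheory.LFunctions.WashingtonSinnottTheorem
import Literature.NumberTheory.LFunctions.SinnottSecondKindCharacters
import HarnessLib

/-!
# Billerey–Menares 2016, Thm. 2.2: the cuspidal congruence from Eisenstein products and
# Washington's theorem (proofs only)

Topic `Literature/NumberTheory/EllipticCurves`; namespace
`Literature.NumberTheory.EllipticCurves.ModularForms.WashingtonLift`.  THEOREMS and auxiliary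
definitions (`restrictGamma1`, `factorA`, `factorB`, `prodFormA`, `prodFormB`); no named fact
(D-0026).

The hypothesis `hC` of `BillereyMenares2016_thm22_exists_newform_of_cuspidalCongruence` — a cusp
form `f₀ ∈ S_k(NM, χ)` with the exact nebentypus congruent to `E = eisensteinLevelRaised N k χ M` —
is obtained here WITHOUT geometric input (no Katz/Carayol lifting lemma), for weights `k ≥ 4`, as
follows ("Wiles' trick" with Washington's theorem on the non-divisibility of `B_{n,θψ̄}/n` for
characters `ψ` of `M`-power conductor, Sinnott's algebraic proof, `WashingtonSinnottTheorem`).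
For a primitive second-kind character `ψ` modulo `M^r` (`SinnottSecondKindCharacters`,
`exists_secondKind_two_units`) put

  `H₀ = E_{k-2}^{ψ,χ} · S_2^{ψ̄,𝟙}/c ∈ M_k(Γ₁(N M^r))`  (`prodFormA`, `k ≥ 5`), resp.
  `H₀ = S_2^{ψ,χ}/c' · S_2^{ψ̄,𝟙}/c ∈ M_4(Γ₁(N M^r))`  (`prodFormB`, `k = 4`),

with `E_w^{ψ,χ}` the two-character Eisenstein series of weight `w ≥ 3`
(`EisensteinSeriesTwoCharacter*`) and `S_2^{·,·}/c` the weight-`2` two-character combinations of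
`℘`-division values normalised by their coefficient constants (`EisensteinSeriesTwoCharacterWeightTwo*`):
a `Γ₀(NM^r)`-equivariant form with character `χ`, with `p`-integral `q`-expansion as soon as
`B_{k-2,χψ̄}/(k-2)` is a `p`-adic unit (Washington), and constant terms `e χ(d_γ) [N ∣ c_γ, M ∤ c_γ]`
along `SL₂(ℤ)` with `e` a `p`-adic unit as soon as `B_{2,ψ}/2` (and `B_{2,χψ̄}/2` for `k = 4`) is
(Washington again).  Lowering the level `r - 1` times with `U_M` (`HeckeUOperatorLevelLowering`,
`descend`) gives a form `H ∈ M_k(Γ₁(NM))` with the same three properties (constant terms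
multiplied by the unit `(M^{k-1}χ(M))^{r-1}`), and
`CuspFormLift.exists_cuspForm_nebentypus_congr_of_integralForm` concludes
(`cuspidalCongruence_of_four_le`).

## References

* N. Billerey, R. Menares, *On the modularity of reducible mod `l` Galois representations*, Math.
  Res. Lett. 23 (2016), §2, Thm. 2.2. [BillereyMenares2016]
* L. C. Washington, *The non-`p`-part of the class number in a cyclotomic `ℤ_p`-extension*,
  Invent. Math. 49 (1978), 87–97. [Washington1978]
* W. Sinnott, *On a theorem of L. Washington*, Astérisque 147–148 (1987), 209–224. [Sinnott1987]
* A. Wiles, *Modular curves and the class group of `ℚ(ζ_p)`*, Invent. Math. 58 (1980), 1–35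
  (products of Eisenstein series with unit constant terms). [Wiles1980]
-/

noncomputable section

open scoped MatrixGroups ModularForm Topology NNReal
open CongruenceSubgroup UpperHalfPlane Filter Matrix.SpecialLinearGroup Complex
open Literature.NumberTheory.LFunctions

namespace Literature.NumberTheory.EllipticCurves.ModularForms

namespace WashingtonLift

/-! ### Restriction of the level `Γ₁(A) ⊇ Γ₁(B)` for `A ∣ B` -/

section Restrict

variable {A B : ℕ} [NeZero A] [NeZero B] {k : ℤ}

omit [NeZero A] [NeZero B] in
/-- `Γ₁(B) ≤ Γ₁(A)` for `A ∣ B`. [folklore] -/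
theorem gamma1_le_of_dvd (h : A ∣ B) : Gamma1 B ≤ Gamma1 A := by
  intro γ hγ
  rw [Gamma1_mem] at hγ ⊢
  obtain ⟨h1, h2, h3⟩ := hγ
  refine ⟨?_, ?_, ?_⟩
  · have := congrArg (ZMod.castHom h (ZMod A)) h1
    rwa [map_intCast, map_one] at this
  · have := congrArg (ZMod.castHom h (ZMod A)) h2
    rwa [map_intCast, map_one] at this
  · have := congrArg (ZMod.castHom h (ZMod A)) h3
    rwa [map_intCast, map_zero] at this

omit [NeZero A] [NeZero B] in
/-- `Γ₀(B) ≤ Γ₀(A)` for `A ∣ B`. [folklore] -/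
theorem gamma0_le_of_dvd (h : A ∣ B) : Gamma0 B ≤ Gamma0 A := by
  intro γ hγ
  rw [Gamma0_mem] at hγ ⊢
  have := congrArg (ZMod.castHom h (ZMod A)) hγ
  rwa [map_intCast, map_zero] at this

/-- **Restriction of the level**: a modular form on `Γ₁(A)` is one on `Γ₁(B)` for `A ∣ B` (same
function; boundedness at the cusps of `Γ₁(B)`, which are those of `SL₂(ℤ)`).
[cite: DiamondShurman2005, §5.1 (forms of level Γ are forms of every smaller level)] -/
def restrictGamma1 (h : A ∣ B) (f : ModularForm (Gamma1 A) k) : ModularForm (Gamma1 B) k where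
  toFun := ⇑f
  slash_action_eq' := by
    rintro _ ⟨γ, hγ, rfl⟩
    exact SlashInvariantFormClass.slash_action_eq f _
      (Subgroup.mem_map_of_mem _ (gamma1_le_of_dvd h hγ))
  holo' := f.holo'
  bdd_at_cusps' {c} hc γ hγ := by
    rw [Subgroup.IsArithmetic.isCusp_iff_isCusp_SL2Z] at hc
    exact ModularFormClass.bdd_at_cusps f
      ((Subgroup.IsArithmetic.isCusp_iff_isCusp_SL2Z _).mpr hc) γ hγ

/-- `restrictGamma1` does not change the function. [folklore] -/
@[simp] theorem coe_restrictGamma1 (h : A ∣ B) (f : ModularForm (Gamma1 A) k) :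
    (⇑(restrictGamma1 h f) : ℍ → ℂ) = ⇑f := rfl

end Restrict

/-! ### Slashing products with split weights -/

/-- `(f g) ∣[k] γ = (f ∣[k₁] γ)(g ∣[k₂] γ)` for `k₁ + k₂ = k`, `γ ∈ SL₂(ℤ)`. [folklore] -/
theorem mul_slash_SL2_of_add_eq {k₁ k₂ k : ℤ} (h : k₁ + k₂ = k) (γ : SL(2, ℤ)) (f g : ℍ → ℂ) :
    (f * g) ∣[k] γ = f ∣[k₁] γ * g ∣[k₂] γ := by
  subst h
  exact ModularForm.mul_slash_SL2 k₁ k₂ γ f g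

/-! ### Entries of `γ ∈ Γ₀(L)` -/

/-- The lower-right entry of `γ ∈ Γ₀(L)` is a unit modulo `L`, with inverse the upper-left entry.
[folklore] -/
theorem apply00_mul_apply11_of_mem_gamma0 {L : ℕ} {γ : SL(2, ℤ)} (hγ : γ ∈ Gamma0 L) :
    ((γ 0 0 : ℤ) : ZMod L) * ((γ 1 1 : ℤ) : ZMod L) = 1 := by
  have hdet := Matrix.SpecialLinearGroup.det_coe γ
  rw [Matrix.det_fin_two] at hdet
  have hc : ((γ 1 0 : ℤ) : ZMod L) = 0 := Gamma0_mem.mp hγ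
  have := congrArg (fun x : ℤ ↦ (x : ZMod L)) hdet
  simp only [Int.cast_sub, Int.cast_mul, Int.cast_one, hc, mul_zero, sub_zero] at this
  exact this

/-- The lower-right entry of `γ ∈ Γ₀(L)` is a unit modulo `L`. [folklore] -/
theorem isUnit_apply11_of_mem_gamma0 {L : ℕ} {γ : SL(2, ℤ)} (hγ : γ ∈ Gamma0 L) :
    IsUnit ((γ 1 1 : ℤ) : ZMod L) :=
  IsUnit.of_mul_eq_one _ (by rw [mul_comm]; exact apply00_mul_apply11_of_mem_gamma0 hγ)

/-! ### Shared facts about the prime `M`, the level `N` and a character `ψ` modulo `M^r` -/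

section Aux

variable {N : ℕ} {M : ℕ} [hM : Fact M.Prime] {r : ℕ} (ψ : DirichletCharacter ℂ (M ^ r))

omit hM in
/-- If `M ∣ Nc'` and `M ∤ N` then `M ∣ c'`. [folklore] -/
theorem prime_dvd_of_dvd_mul_left (hMN : M.Coprime N) {c' : ℤ} (h : (M : ℤ) ∣ N * c') : (M : ℤ) ∣ c' :=
  Int.dvd_of_dvd_mul_right_of_gcd_one h (by
    rw [Int.gcd_comm]; exact Int.isCoprime_iff_gcd_eq_one.mp (Nat.isCoprime_iff_coprime.mpr hMN.symm))

/-- Multiples of `M` are non-units modulo `M^r` (`r ≥ 1`). [folklore] -/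
theorem not_isUnit_of_prime_dvd (hr : 1 ≤ r) {t : ℤ} (ht : (M : ℤ) ∣ t) :
    ¬ IsUnit ((t : ℤ) : ZMod (M ^ r)) := by
  intro hu
  have hcop := (ZMod.coe_int_isUnit_iff_isCoprime t (M ^ r)).mp hu
  have hMr : (M : ℤ) ∣ ((M ^ r : ℕ) : ℤ) := by push_cast; exact dvd_pow_self _ (by omega)
  have : (M : ℤ) ∣ 1 := by
    obtain ⟨a, b, hab⟩ := hcop
    rw [← hab]; exact dvd_add (dvd_mul_of_dvd_right hMr a) (dvd_mul_of_dvd_right ht b)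
  exact hM.out.one_lt.ne' (by exact_mod_cast Int.eq_one_of_dvd_one (by positivity) this)

/-- Non-multiples of `M` are units modulo `M^r`. [folklore] -/
theorem isUnit_of_not_prime_dvd {t : ℤ} (ht : ¬ (M : ℤ) ∣ t) : IsUnit ((t : ℤ) : ZMod (M ^ r)) := by
  rw [ZMod.coe_int_isUnit_iff_isCoprime]
  push_cast
  exact ((Prime.coprime_iff_not_dvd (Nat.prime_iff_prime_int.mp hM.out)).mpr ht).pow_left

omit hM in
/-- `N` is a unit modulo `M^r` when `M ∤ N`. [folklore] -/
theorem isUnit_natCast_level (hMN : M.Coprime N) : IsUnit ((N : ZMod (M ^ r))) :=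
  (ZMod.isUnit_iff_coprime N (M ^ r)).mpr (Nat.Coprime.pow_right r hMN.symm)

/-- `ψ⁻¹(Nc') ψ(c') = ψ⁻¹(N)` for `M ∤ c'`. [folklore] -/
theorem inv_apply_mul_of_not_dvd {c' : ℤ} (hc' : ¬ (M : ℤ) ∣ c') :
    ψ⁻¹ (((N : ℤ) * c' : ℤ) : ZMod (M ^ r)) * ψ ((c' : ℤ) : ZMod (M ^ r)) = ψ⁻¹ (N : ZMod (M ^ r)) := by
  have hc'u : IsUnit ((c' : ℤ) : ZMod (M ^ r)) := isUnit_of_not_prime_dvd hc'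
  have hc'0 : ψ ((c' : ℤ) : ZMod (M ^ r)) ≠ 0 := (hc'u.map ψ).ne_zero
  rw [MulChar.inv_apply_eq_inv', MulChar.inv_apply_eq_inv']
  push_cast
  rw [map_mul, mul_inv, mul_assoc, inv_mul_cancel₀ hc'0, mul_one]

/-- A primitive character modulo `M^r`, `r ≥ 1`, is non-trivial. [folklore] -/
theorem ne_one_of_isPrimitive_pow (hr : 1 ≤ r) (hψ : ψ.IsPrimitive) : ψ ≠ 1 :=
  ne_one_of_isPrimitive_of_level_ne_one ψ hψ (Nat.one_lt_pow (by omega) hM.out.one_lt).ne'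

end Aux

/-! ### The product form `H₀ = E_{k-2}^{ψ,χ} · S_2^{ψ̄,𝟙}/c` (`k ≥ 5`) -/

section ProdA

variable {N : ℕ} [NeZero N] (χ : DirichletCharacter ℂ N) {M : ℕ} [hM : Fact M.Prime] {r : ℕ}
  (ψ : DirichletCharacter ℂ (M ^ r)) (k : ℕ)

/-- `3 ≤ k - 2` as integers for `5 ≤ k`. [folklore] -/
theorem three_le_sub_two (hk : 5 ≤ k) : (3 : ℤ) ≤ ((k - 2 : ℕ) : ℤ) := by
  have : 3 ≤ k - 2 := by omega
  exact_mod_cast this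

/-- The normalised weight-`2` factor `S_2^{ψ̄,𝟙}/c` on `Γ₁(M^r · 1)`. [cite: DiamondShurman2005, Thm. 4.6.2] -/
def factorB : ModularForm (Gamma1 (M ^ r * 1)) 2 :=
  (twoCharTwoConst (M ^ r) (1 : DirichletCharacter ℂ 1))⁻¹ •
    twoCharTwoMF ψ⁻¹ (1 : DirichletCharacter ℂ 1)

/-- The function of `factorB`. [folklore] -/
theorem coe_factorB : (⇑(factorB ψ) : ℍ → ℂ) =
    (twoCharTwoConst (M ^ r) (1 : DirichletCharacter ℂ 1))⁻¹ •
      (⇑(twoCharTwoMF ψ⁻¹ (1 : DirichletCharacter ℂ 1)) : ℍ → ℂ) := rfl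

/-- `S_2^{ψ̄,𝟙}/c ∣₂ γ = ψ̄(d) · S_2^{ψ̄,𝟙}/c` for `γ ∈ Γ₀(M^r)`. [cite: DiamondShurman2005, Thm. 4.6.2] -/
theorem factorB_slash_of_mem_gamma0 {γ : SL(2, ℤ)} (hγ : γ ∈ Gamma0 (M ^ r * 1)) :
    (⇑(factorB ψ) : ℍ → ℂ) ∣[(2 : ℤ)] γ = ψ⁻¹ ((γ 1 1 : ℤ) : ZMod (M ^ r)) • (⇑(factorB ψ) : ℍ → ℂ) := by
  rw [coe_factorB, ModularForm.SL_smul_slash, twoCharTwoMF_slash_of_mem_gamma0 ψ⁻¹ _ hγ,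
    MulChar.one_apply (isUnit_of_subsingleton _), mul_one, smul_comm]

/-- The limit of `S_2^{ψ̄,𝟙}/c ∣₂ γ` at `i∞`: `e₂ ψ̄(-c_γ)`. [cite: DiamondShurman2005, Thm. 4.6.2] -/
theorem tendsto_factorB_slash_atImInfty (hr : 1 ≤ r) (hψ : ψ.IsPrimitive) (hψ1 : ψ (-1) = 1)
    (γ : SL(2, ℤ)) :
    Tendsto ((⇑(factorB ψ) : ℍ → ℂ) ∣[(2 : ℤ)] γ) atImInfty
      (𝓝 (twoCharTwoUnit ψ⁻¹ (1 : DirichletCharacter ℂ 1) * ψ⁻¹ ((-(γ 1 0 : ℤ) : ℤ) : ZMod (M ^ r)))) := by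
  have hψ' := Literature.NumberTheory.LFunctions.isPrimitive_inv ψ hψ
  have hne : ψ⁻¹ ≠ 1 := ne_one_of_isPrimitive_pow ψ⁻¹ hr hψ'
  have hpar : ψ⁻¹ (-1) * (1 : DirichletCharacter ℂ 1) (-1) = 1 := by
    rw [inv_apply_neg_one, hψ1, MulChar.one_apply (isUnit_of_subsingleton _), mul_one]
  haveI : NeZero (M ^ r) := ⟨pow_ne_zero _ hM.out.ne_zero⟩
  have h := inv_twoCharTwoConst_mul_twoCharTwoCusp_of_eq_mul (u := M ^ r) (v := 1) (γ := γ) ψ⁻¹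
    (1 : DirichletCharacter ℂ 1) hψ' hne DirichletCharacter.isPrimitive_one_level_one
    (Nat.coprime_one_right _) hpar (γ 1 0) (by push_cast; ring)
  rw [MulChar.one_apply (isUnit_of_subsingleton _), mul_one] at h
  rw [← h, coe_factorB, ModularForm.SL_smul_slash]
  exact (tendsto_twoCharTwoMF_slash_atImInfty ψ⁻¹ (1 : DirichletCharacter ℂ 1) γ).const_mul _

/-- `p`-integrality of the coefficients of `S_2^{ψ̄,𝟙}/c`. [cite: DiamondShurman2005, Thm. 4.6.2] -/
theorem valuation_qExpansion_coeff_factorB_le_one {p : ℕ} [Fact p.Prime] (ι : PadicAlgCl p ≃+* ℂ)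
    (hr : 1 ≤ r) (hψ : ψ.IsPrimitive) (hψ1 : ψ (-1) = 1) (n : ℕ) :
    Valued.v (ι.symm ((qExpansion 1 (⇑(factorB ψ) : ℍ → ℂ)).coeff n)) ≤ 1 := by
  haveI : NeZero (M ^ r * 1) := ⟨by rw [mul_one]; exact pow_ne_zero _ hM.out.ne_zero⟩
  have hψ' := Literature.NumberTheory.LFunctions.isPrimitive_inv ψ hψ
  have hne : ψ⁻¹ ≠ 1 := ne_one_of_isPrimitive_pow ψ⁻¹ hr hψ'
  have hpar : ψ⁻¹ (-1) * (1 : DirichletCharacter ℂ 1) (-1) = 1 := by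
    rw [inv_apply_neg_one, hψ1, MulChar.one_apply (isUnit_of_subsingleton _), mul_one]
  rw [factorB, ModularForm.IsGLPos.coe_smul,
    ModularForm.qExpansion_smul one_pos (HeckeTGamma1.one_mem_strictPeriods_Gamma1 _) _
      (twoCharTwoMF ψ⁻¹ (1 : DirichletCharacter ℂ 1)),
    PowerSeries.coeff_smul, smul_eq_mul]
  exact valuation_inv_twoCharTwoConst_mul_coeff_le_one ψ⁻¹ _ ι hne
    DirichletCharacter.isPrimitive_one_level_one hpar n

/-- **The product form `H₀ = E_{k-2}^{ψ,χ} · S_2^{ψ̄,𝟙}/c ∈ M_k(Γ₁(N M^r))`** (`k ≥ 5`).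
[cite: Wiles1980, §2 (products of Eisenstein series)] -/
def prodFormA (hk : 5 ≤ k) : ModularForm (Gamma1 (N * M ^ r)) k :=
  ModularForm.mcast (by omega)
    ((restrictGamma1 (by rw [mul_comm]) (eisensteinTwoCharMF ((k - 2 : ℕ) : ℤ) ψ χ
        (three_le_sub_two k hk))).mul
      (restrictGamma1 (by rw [mul_one]; exact dvd_mul_left _ _) (factorB ψ)))

/-- `H₀` as a function: the product of the two factors. [folklore] -/
theorem coe_prodFormA (hk : 5 ≤ k) :
    (⇑(prodFormA χ ψ k hk) : ℍ → ℂ) =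
      (⇑(eisensteinTwoCharMF ((k - 2 : ℕ) : ℤ) ψ χ (three_le_sub_two k hk)) : ℍ → ℂ) *
        ⇑(factorB ψ) := by
  rw [prodFormA, ModularForm.coe_mcast, ModularForm.coe_mul, coe_restrictGamma1, coe_restrictGamma1]

/-- **`H₀` is `Γ₀(N M^r)`-equivariant with character `χ`**: the nebentypus `(ψχ)·ψ̄ = χ`.
[cite: DiamondShurman2005, Thm. 4.5.1, Thm. 4.6.2] -/
theorem prodFormA_slash_of_mem_gamma0 (hk : 5 ≤ k) {γ : SL(2, ℤ)}
    (hγ : γ ∈ Gamma0 (N * M ^ r)) :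
    (⇑(prodFormA χ ψ k hk) : ℍ → ℂ) ∣[(k : ℤ)] γ =
      χ ((γ 1 1 : ℤ) : ZMod N) • ⇑(prodFormA χ ψ k hk) := by
  have hγA : γ ∈ Gamma0 (M ^ r * N) := by rwa [mul_comm] at hγ
  have hγr : γ ∈ Gamma0 (M ^ r) := gamma0_le_of_dvd (dvd_mul_left (M ^ r) N) hγ
  have hγB : γ ∈ Gamma0 (M ^ r * 1) := by rwa [mul_one]
  rw [coe_prodFormA,
    mul_slash_SL2_of_add_eq (k₁ := ((k - 2 : ℕ) : ℤ)) (k₂ := 2) (by omega) γ,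
    eisensteinTwoCharMF_slash_of_mem_gamma0 ψ χ _ hγA, factorB_slash_of_mem_gamma0 ψ hγB,
    smul_mul_smul_comm]
  congr 1
  have hd : IsUnit ((γ 1 1 : ℤ) : ZMod (M ^ r)) := isUnit_apply11_of_mem_gamma0 hγr
  have hne : ψ ((γ 1 1 : ℤ) : ZMod (M ^ r)) ≠ 0 := (hd.map ψ).ne_zero
  rw [MulChar.inv_apply_eq_inv', mul_comm (ψ _) (χ _), mul_assoc, mul_inv_cancel₀ hne, mul_one]

/-- `(-1)^{-(k-2)} · (-1)^k = 1` in `ℂ`. [folklore] -/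
theorem neg_one_zpow_neg_sub_two_mul (hk : 5 ≤ k) :
    (-1 : ℂ) ^ (-(((k - 2 : ℕ) : ℤ))) * (-1) ^ k = 1 := by
  rw [_root_.zpow_neg, zpow_natCast, ← inv_pow, inv_neg, inv_one, ← pow_add]
  have : _root_.Even (k - 2 + k) := ⟨k - 1, by omega⟩
  exact this.neg_one_pow

/-- **Constant terms of `H₀` along `SL₂(ℤ)`**: `H₀ ∣[k] γ → 2e₂ψ̄(N) χ(d_γ)` if `N ∣ c_γ` and
`M ∤ c_γ`, and `→ 0` otherwise. [cite: DiamondShurman2005, §4.2, §4.6] -/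
theorem tendsto_prodFormA_slash_atImInfty (hk : 5 ≤ k) (hr : 1 ≤ r) (hMN : M.Coprime N)
    (hψ : ψ.IsPrimitive) (hχpar : χ (-1) = (-1) ^ k) (hψ1 : ψ (-1) = 1) (γ : SL(2, ℤ)) :
    Tendsto ((⇑(prodFormA χ ψ k hk) : ℍ → ℂ) ∣[(k : ℤ)] γ) atImInfty
      (𝓝 (if (N : ℤ) ∣ γ 1 0 ∧ ¬ (M : ℤ) ∣ γ 1 0 then
        (2 * twoCharTwoUnit ψ⁻¹ (1 : DirichletCharacter ℂ 1) * ψ⁻¹ (N : ZMod (M ^ r))) *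
          χ ((γ 1 1 : ℤ) : ZMod N) else 0)) := by
  have hA := tendsto_eisensteinTwoCharMF_slash_atImInfty ψ χ (three_le_sub_two k hk) γ
  have hB := tendsto_factorB_slash_atImInfty ψ hr hψ hψ1 γ
  rw [coe_prodFormA, mul_slash_SL2_of_add_eq (k₁ := ((k - 2 : ℕ) : ℤ)) (k₂ := 2) (by omega) γ]
  have hAB : Tendsto ((⇑(eisensteinTwoCharMF ((k - 2 : ℕ) : ℤ) ψ χ (three_le_sub_two k hk)) : ℍ → ℂ)
      ∣[((k - 2 : ℕ) : ℤ)] γ * (⇑(factorB ψ) : ℍ → ℂ) ∣[(2 : ℤ)] γ) atImInfty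
      (𝓝 (twoCharCuspSum ((k - 2 : ℕ) : ℤ) ψ χ γ *
        (twoCharTwoUnit ψ⁻¹ (1 : DirichletCharacter ℂ 1) * ψ⁻¹ ((-(γ 1 0 : ℤ) : ℤ) : ZMod (M ^ r))))) :=
    hA.mul hB
  convert hAB using 2
  set e₂ := twoCharTwoUnit ψ⁻¹ (1 : DirichletCharacter ℂ 1) with he₂
  have hψinv1 : ψ⁻¹ (-1) = 1 := by rw [inv_apply_neg_one, hψ1]
  have hneg : ∀ t : ℤ, ψ ((-t : ℤ) : ZMod (M ^ r)) = ψ ((t : ℤ) : ZMod (M ^ r)) := by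
    intro t; rw [Int.cast_neg, ← neg_one_mul, map_mul, hψ1, one_mul]
  have hneg' : ∀ t : ℤ, ψ⁻¹ ((-t : ℤ) : ZMod (M ^ r)) = ψ⁻¹ ((t : ℤ) : ZMod (M ^ r)) := by
    intro t; rw [Int.cast_neg, ← neg_one_mul, map_mul, hψinv1, one_mul]
  by_cases hNc : (N : ℤ) ∣ γ 1 0
  · obtain ⟨c', hc'⟩ := hNc
    rw [twoCharCuspSum_of_eq_mul ψ χ c' hc', hneg' (γ 1 0)]
    by_cases hMc : (M : ℤ) ∣ γ 1 0
    · -- `M ∣ c'`, so `ψ(±c') = 0`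
      rw [if_neg fun h ↦ h.2 hMc]
      have hMc' : (M : ℤ) ∣ c' := prime_dvd_of_dvd_mul_left hMN (hc' ▸ hMc)
      rw [ψ.map_nonunit (not_isUnit_of_prime_dvd hr (dvd_neg.mpr hMc')),
        ψ.map_nonunit (not_isUnit_of_prime_dvd hr hMc')]
      simp
    · rw [if_pos ⟨⟨c', hc'⟩, hMc⟩]
      have hNc0 : ((γ 1 0 : ℤ) : ZMod N) = 0 := by
        rw [hc']; push_cast; rw [ZMod.natCast_self, zero_mul]
      have hγN : γ ∈ Gamma0 N := Gamma0_mem.mpr hNc0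
      have ha : χ⁻¹ ((γ 0 0 : ℤ) : ZMod N) = χ ((γ 1 1 : ℤ) : ZMod N) := inv_apply00_eq_apply11 χ hγN
      have ha' : χ⁻¹ (-((γ 0 0 : ℤ) : ZMod N)) = χ (-1) * χ ((γ 1 1 : ℤ) : ZMod N) := by
        rw [← neg_one_mul, map_mul, inv_apply_neg_one, ha]
      have hMc' : ¬ (M : ℤ) ∣ c' := fun h ↦ hMc (hc' ▸ dvd_mul_of_dvd_right h _)
      have hψc := inv_apply_mul_of_not_dvd (N := N) ψ hMc'
      have hs := neg_one_zpow_neg_sub_two_mul k hk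
      rw [hneg c', ha, ha', hχpar, hc']
      linear_combination (-(e₂ * χ ((γ 1 1 : ℤ) : ZMod N) *
          (1 + (-1 : ℂ) ^ (-(((k - 2 : ℕ) : ℤ))) * (-1) ^ k))) * hψc -
        (e₂ * χ ((γ 1 1 : ℤ) : ZMod N) * ψ⁻¹ (N : ZMod (M ^ r))) * hs
  · rw [if_neg fun h ↦ hNc h.1, twoCharCuspSum_of_not_dvd ψ χ hNc, zero_mul]

/-- `(-1)^k = (-1)^{k-2}` for `k ≥ 2`. [folklore] -/
theorem neg_one_pow_eq_pow_sub_two (hk : 5 ≤ k) : (-1 : ℂ) ^ k = (-1) ^ (k - 2) := by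
  conv_lhs => rw [← Nat.sub_add_cancel (show 2 ≤ k by omega)]
  rw [pow_add]
  norm_num

/-- **`p`-integrality of the `q`-expansion of `H₀`** when `B_{k-2,χψ̄}/(k-2)` is a `p`-adic unit
(the second factor is integral unconditionally). [cite: DiamondShurman2005, §4.5–4.6] -/
theorem valuation_qExpansion_coeff_prodFormA_le_one {p : ℕ} [Fact p.Prime] (ι : PadicAlgCl p ≃+* ℂ)
    (hk : 5 ≤ k) (hr : 1 ≤ r) (hψ : ψ.IsPrimitive) (hχ : χ.IsPrimitive) (hMN : M.Coprime N)
    (hχpar : χ (-1) = (-1) ^ k) (hψ1 : ψ (-1) = 1) (hpN : ¬ p ∣ N)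
    (hBA : Valued.v (ι.symm (generalizedBernoulli (k - 2)
        (DirichletCharacter.changeLevel (dvd_mul_right (M ^ r) N) ψ *
          DirichletCharacter.changeLevel (dvd_mul_left N (M ^ r)) χ⁻¹)⁻¹ / (k - 2 : ℕ))) = 1)
    (n : ℕ) : Valued.v (ι.symm ((qExpansion 1 ⇑(prodFormA χ ψ k hk)).coeff n)) ≤ 1 := by
  set A : ModularForm (Gamma1 (N * M ^ r)) ((k - 2 : ℕ) : ℤ) := restrictGamma1 (by rw [mul_comm])
    (eisensteinTwoCharMF ((k - 2 : ℕ) : ℤ) ψ χ (three_le_sub_two k hk)) with hAdef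
  set B : ModularForm (Gamma1 (N * M ^ r)) 2 :=
    restrictGamma1 (by rw [mul_one]; exact dvd_mul_left _ _) (factorB ψ) with hBdef
  have hcoe : (⇑(prodFormA χ ψ k hk) : ℍ → ℂ) = ⇑A * ⇑B := coe_prodFormA χ ψ k hk
  have hq : qExpansion 1 (⇑(prodFormA χ ψ k hk) : ℍ → ℂ) = qExpansion 1 ⇑A * qExpansion 1 ⇑B := by
    rw [hcoe]
    exact ModularForm.qExpansion_mul_coe one_pos (HeckeTGamma1.one_mem_strictPeriods_Gamma1 _) A B
  rw [hq, PowerSeries.coeff_mul, map_sum]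
  refine Valuation.map_sum_le _ fun ij _ ↦ ?_
  rw [map_mul, Valuation.map_mul]
  have hu : 1 < M ^ r := Nat.one_lt_pow (by omega) hM.out.one_lt
  refine mul_le_one' ?_ ?_
  · have hparA : ψ (-1) * χ (-1) = (-1) ^ (k - 2) := by
      rw [hψ1, one_mul, hχpar, neg_one_pow_eq_pow_sub_two k hk]
    exact valuation_qExpansion_coeff_eisensteinTwoCharMF_le_one (k - 2) ψ χ ι (by omega) hψ hχ
      (Nat.Coprime.pow_left r hMN) hparA hu hpN hBA ij.1
  · rw [hBdef, coe_restrictGamma1]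
    exact valuation_qExpansion_coeff_factorB_le_one ψ ι hr hψ hψ1 ij.2

end ProdA

/-! ### The product form `H₀ = S_2^{ψ,χ}/c' · S_2^{ψ̄,𝟙}/c` (`k = 4`) -/

section ProdB

variable {N : ℕ} [NeZero N] (χ : DirichletCharacter ℂ N) {M : ℕ} [hM : Fact M.Prime] {r : ℕ}
  (ψ : DirichletCharacter ℂ (M ^ r))

/-- The normalised weight-`2` factor `S_2^{ψ,χ}/c'` on `Γ₁(M^r N)`. [cite: DiamondShurman2005, Thm. 4.6.2] -/
def factorA : ModularForm (Gamma1 (M ^ r * N)) 2 :=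
  (twoCharTwoConst (M ^ r) χ)⁻¹ • twoCharTwoMF ψ χ

/-- The function of `factorA`. [folklore] -/
theorem coe_factorA : (⇑(factorA χ ψ) : ℍ → ℂ) =
    (twoCharTwoConst (M ^ r) χ)⁻¹ • (⇑(twoCharTwoMF ψ χ) : ℍ → ℂ) := rfl

/-- `S_2^{ψ,χ}/c' ∣₂ γ = ψ(d)χ(d) · S_2^{ψ,χ}/c'` for `γ ∈ Γ₀(M^r N)`. [cite: DiamondShurman2005, Thm. 4.6.2] -/
theorem factorA_slash_of_mem_gamma0 {γ : SL(2, ℤ)} (hγ : γ ∈ Gamma0 (M ^ r * N)) :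
    (⇑(factorA χ ψ) : ℍ → ℂ) ∣[(2 : ℤ)] γ =
      (ψ ((γ 1 1 : ℤ) : ZMod (M ^ r)) * χ ((γ 1 1 : ℤ) : ZMod N)) • (⇑(factorA χ ψ) : ℍ → ℂ) := by
  rw [coe_factorA, ModularForm.SL_smul_slash, twoCharTwoMF_slash_of_mem_gamma0 ψ χ hγ, smul_comm]

/-- The limit of `S_2^{ψ,χ}/c' ∣₂ γ` at `i∞`: `0` if `N ∤ c_γ`, `e₂' ψ(-c') χ(d)` if `c_γ = Nc'`.
[cite: DiamondShurman2005, Thm. 4.6.2] -/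
theorem tendsto_factorA_slash_atImInfty (γ : SL(2, ℤ)) :
    Tendsto ((⇑(factorA χ ψ) : ℍ → ℂ) ∣[(2 : ℤ)] γ) atImInfty
      (𝓝 ((twoCharTwoConst (M ^ r) χ)⁻¹ * twoCharTwoCusp ψ χ γ)) := by
  rw [coe_factorA, ModularForm.SL_smul_slash]
  exact (tendsto_twoCharTwoMF_slash_atImInfty ψ χ γ).const_mul _

/-- `p`-integrality of the coefficients of `S_2^{ψ,χ}/c'`. [cite: DiamondShurman2005, Thm. 4.6.2] -/
theorem valuation_qExpansion_coeff_factorA_le_one {p : ℕ} [Fact p.Prime] (ι : PadicAlgCl p ≃+* ℂ)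
    (hr : 1 ≤ r) (hψ : ψ.IsPrimitive) (hχ : χ.IsPrimitive) (hpar : ψ (-1) * χ (-1) = 1) (n : ℕ) :
    Valued.v (ι.symm ((qExpansion 1 (⇑(factorA χ ψ) : ℍ → ℂ)).coeff n)) ≤ 1 := by
  haveI : NeZero (M ^ r * N) := ⟨mul_ne_zero (pow_ne_zero _ hM.out.ne_zero) (NeZero.ne N)⟩
  have hne : ψ ≠ 1 := ne_one_of_isPrimitive_pow ψ hr hψ
  rw [factorA, ModularForm.IsGLPos.coe_smul,
    ModularForm.qExpansion_smul one_pos (HeckeTGamma1.one_mem_strictPeriods_Gamma1 _) _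
      (twoCharTwoMF ψ χ),
    PowerSeries.coeff_smul, smul_eq_mul]
  exact valuation_inv_twoCharTwoConst_mul_coeff_le_one ψ χ ι hne hχ hpar n

/-- **The product form `H₀ = S_2^{ψ,χ}/c' · S_2^{ψ̄,𝟙}/c ∈ M_4(Γ₁(N M^r))`.**
[cite: Wiles1980, §2 (products of Eisenstein series)] -/
def prodFormB : ModularForm (Gamma1 (N * M ^ r)) (4 : ℕ) :=
  ModularForm.mcast (by norm_num)
    ((restrictGamma1 (by rw [mul_comm]) (factorA χ ψ)).mul
      (restrictGamma1 (by rw [mul_one]; exact dvd_mul_left _ _) (factorB ψ)))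

/-- `H₀` as a function. [folklore] -/
theorem coe_prodFormB :
    (⇑(prodFormB χ ψ) : ℍ → ℂ) = (⇑(factorA χ ψ) : ℍ → ℂ) * ⇑(factorB ψ) := by
  rw [prodFormB, ModularForm.coe_mcast, ModularForm.coe_mul, coe_restrictGamma1, coe_restrictGamma1]

/-- **`H₀` is `Γ₀(N M^r)`-equivariant with character `χ`.** [cite: DiamondShurman2005, Thm. 4.6.2] -/
theorem prodFormB_slash_of_mem_gamma0 {γ : SL(2, ℤ)} (hγ : γ ∈ Gamma0 (N * M ^ r)) :
    (⇑(prodFormB χ ψ) : ℍ → ℂ) ∣[((4 : ℕ) : ℤ)] γ =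
      χ ((γ 1 1 : ℤ) : ZMod N) • ⇑(prodFormB χ ψ) := by
  have hγA : γ ∈ Gamma0 (M ^ r * N) := by rwa [mul_comm] at hγ
  have hγr : γ ∈ Gamma0 (M ^ r) := gamma0_le_of_dvd (dvd_mul_left (M ^ r) N) hγ
  have hγB : γ ∈ Gamma0 (M ^ r * 1) := by rwa [mul_one]
  rw [coe_prodFormB, mul_slash_SL2_of_add_eq (k₁ := 2) (k₂ := 2) (by norm_num) γ,
    factorA_slash_of_mem_gamma0 χ ψ hγA, factorB_slash_of_mem_gamma0 ψ hγB, smul_mul_smul_comm]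
  congr 1
  have hd : IsUnit ((γ 1 1 : ℤ) : ZMod (M ^ r)) := isUnit_apply11_of_mem_gamma0 hγr
  have hne : ψ ((γ 1 1 : ℤ) : ZMod (M ^ r)) ≠ 0 := (hd.map ψ).ne_zero
  rw [MulChar.inv_apply_eq_inv', mul_comm (ψ _) (χ _), mul_assoc, mul_inv_cancel₀ hne, mul_one]

/-- **Constant terms of `H₀` along `SL₂(ℤ)`** (`k = 4`): `e₂' e₂ ψ̄(N) χ(d_γ) [N ∣ c_γ, M ∤ c_γ]`.
[cite: DiamondShurman2005, §4.6] -/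
theorem tendsto_prodFormB_slash_atImInfty (hr : 1 ≤ r) (hMN : M.Coprime N) (hψ : ψ.IsPrimitive)
    (hχ : χ.IsPrimitive) (hχpar : χ (-1) = 1) (hψ1 : ψ (-1) = 1) (γ : SL(2, ℤ)) :
    Tendsto ((⇑(prodFormB χ ψ) : ℍ → ℂ) ∣[((4 : ℕ) : ℤ)] γ) atImInfty
      (𝓝 (if (N : ℤ) ∣ γ 1 0 ∧ ¬ (M : ℤ) ∣ γ 1 0 then
        (twoCharTwoUnit ψ χ * twoCharTwoUnit ψ⁻¹ (1 : DirichletCharacter ℂ 1) *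
            ψ⁻¹ (N : ZMod (M ^ r))) * χ ((γ 1 1 : ℤ) : ZMod N) else 0)) := by
  have hpar : ψ (-1) * χ (-1) = 1 := by rw [hψ1, hχpar, one_mul]
  have hne : ψ ≠ 1 := ne_one_of_isPrimitive_pow ψ hr hψ
  have hA := tendsto_factorA_slash_atImInfty χ ψ γ
  have hB := tendsto_factorB_slash_atImInfty ψ hr hψ hψ1 γ
  rw [coe_prodFormB, mul_slash_SL2_of_add_eq (k₁ := 2) (k₂ := 2) (by norm_num) γ]
  have hAB : Tendsto ((⇑(factorA χ ψ) : ℍ → ℂ) ∣[(2 : ℤ)] γ * (⇑(factorB ψ) : ℍ → ℂ) ∣[(2 : ℤ)] γ)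
      atImInfty (𝓝 ((twoCharTwoConst (M ^ r) χ)⁻¹ * twoCharTwoCusp ψ χ γ *
        (twoCharTwoUnit ψ⁻¹ (1 : DirichletCharacter ℂ 1) * ψ⁻¹ ((-(γ 1 0 : ℤ) : ℤ) : ZMod (M ^ r))))) :=
    hA.mul hB
  convert hAB using 2
  have hψinv1 : ψ⁻¹ (-1) = 1 := by rw [inv_apply_neg_one, hψ1]
  have hneg : ∀ t : ℤ, ψ ((-t : ℤ) : ZMod (M ^ r)) = ψ ((t : ℤ) : ZMod (M ^ r)) := by
    intro t; rw [Int.cast_neg, ← neg_one_mul, map_mul, hψ1, one_mul]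
  have hneg' : ∀ t : ℤ, ψ⁻¹ ((-t : ℤ) : ZMod (M ^ r)) = ψ⁻¹ ((t : ℤ) : ZMod (M ^ r)) := by
    intro t; rw [Int.cast_neg, ← neg_one_mul, map_mul, hψinv1, one_mul]
  by_cases hNc : (N : ℤ) ∣ γ 1 0
  · obtain ⟨c', hc'⟩ := hNc
    rw [inv_twoCharTwoConst_mul_twoCharTwoCusp_of_eq_mul ψ χ hψ hne hχ (Nat.Coprime.pow_left r hMN)
      hpar c' hc', hneg' (γ 1 0), hneg c']
    by_cases hMc : (M : ℤ) ∣ γ 1 0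
    · rw [if_neg fun h ↦ h.2 hMc]
      have hMc' : (M : ℤ) ∣ c' := prime_dvd_of_dvd_mul_left hMN (hc' ▸ hMc)
      rw [ψ.map_nonunit (not_isUnit_of_prime_dvd hr hMc')]
      simp
    · rw [if_pos ⟨⟨c', hc'⟩, hMc⟩]
      have hMc' : ¬ (M : ℤ) ∣ c' := fun h ↦ hMc (hc' ▸ dvd_mul_of_dvd_right h _)
      have hψc := inv_apply_mul_of_not_dvd (N := N) ψ hMc'
      rw [hc']
      linear_combination (-(twoCharTwoUnit ψ χ * twoCharTwoUnit ψ⁻¹ (1 : DirichletCharacter ℂ 1) *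
        χ ((γ 1 1 : ℤ) : ZMod N))) * hψc
  · rw [if_neg fun h ↦ hNc h.1, twoCharTwoCusp_of_not_dvd ψ χ hne hNc, mul_zero, zero_mul]

/-- **`p`-integrality of the `q`-expansion of `H₀`** (`k = 4`; both factors are integral).
[cite: DiamondShurman2005, §4.6] -/
theorem valuation_qExpansion_coeff_prodFormB_le_one {p : ℕ} [Fact p.Prime] (ι : PadicAlgCl p ≃+* ℂ)
    (hr : 1 ≤ r) (hψ : ψ.IsPrimitive) (hχ : χ.IsPrimitive) (hχpar : χ (-1) = 1) (hψ1 : ψ (-1) = 1)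
    (n : ℕ) : Valued.v (ι.symm ((qExpansion 1 ⇑(prodFormB χ ψ)).coeff n)) ≤ 1 := by
  set A : ModularForm (Gamma1 (N * M ^ r)) 2 := restrictGamma1 (by rw [mul_comm]) (factorA χ ψ)
    with hAdef
  set B : ModularForm (Gamma1 (N * M ^ r)) 2 :=
    restrictGamma1 (by rw [mul_one]; exact dvd_mul_left _ _) (factorB ψ) with hBdef
  have hcoe : (⇑(prodFormB χ ψ) : ℍ → ℂ) = ⇑A * ⇑B := coe_prodFormB χ ψ
  have hq : qExpansion 1 (⇑(prodFormB χ ψ) : ℍ → ℂ) = qExpansion 1 ⇑A * qExpansion 1 ⇑B := by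
    rw [hcoe]
    exact ModularForm.qExpansion_mul_coe one_pos (HeckeTGamma1.one_mem_strictPeriods_Gamma1 _) A B
  rw [hq, PowerSeries.coeff_mul, map_sum]
  refine Valuation.map_sum_le _ fun ij _ ↦ ?_
  rw [map_mul, Valuation.map_mul]
  have hpar : ψ (-1) * χ (-1) = 1 := by rw [hψ1, hχpar, one_mul]
  refine mul_le_one' ?_ ?_
  · rw [hAdef, coe_restrictGamma1]
    exact valuation_qExpansion_coeff_factorA_le_one χ ψ ι hr hψ hχ hpar ij.1
  · rw [hBdef, coe_restrictGamma1]
    exact valuation_qExpansion_coeff_factorB_le_one ψ ι hr hψ hψ1 ij.2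

end ProdB

/-! ### Lowering the level from `N M^s` to `N M` -/

section Descend

variable {p : ℕ} [Fact p.Prime]

/-- Values of a Dirichlet character at units are `p`-adic units. [folklore] -/
theorem valuation_symm_apply_unit_eq_one (ι : PadicAlgCl p ≃+* ℂ) {N : ℕ} [NeZero N]
    (χ : DirichletCharacter ℂ N) (u : (ZMod N)ˣ) : Valued.v (ι.symm (χ u)) = 1 := by
  refine valuation_eq_one_of_pow_eq_one (Fintype.card_ne_zero (α := (ZMod N)ˣ)) ?_
  rw [← map_pow, ← MulChar.coe_toUnitHom, ← Units.val_pow_eq_pow_val, ← map_pow, pow_card_eq_one,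
    map_one, Units.val_one, map_one]

/-- **The descent**: a form on `Γ₁(N M^s)` (`s ≥ 1`) which is `Γ₀(N M^s)`-equivariant with `χ`,
`p`-integral, and has constant terms `e χ(d_γ) [N ∣ c_γ, M ∤ c_γ]` along `SL₂(ℤ)` with a `p`-adic
unit `e`, yields (applying `U_M` `s - 1` times) a form on `Γ₁(NM)` with the same three properties.
[cite: AtkinLehner1970, Lemma 7] [cite: DiamondShurman2005, §5.2] -/
theorem descend (ι : PadicAlgCl p ≃+* ℂ) {N : ℕ} [NeZero N] (χ : DirichletCharacter ℂ N)
    {M : ℕ} [hM : Fact M.Prime] (hMN : M.Coprime N) (hMp : M ≠ p) (k : ℤ) (s : ℕ) (hs : 1 ≤ s)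
    (H : ModularForm (Gamma1 (N * M ^ s)) k)
    (h1 : ∀ γ : SL(2, ℤ), γ ∈ Gamma0 (N * M ^ s) →
      (⇑H : ℍ → ℂ) ∣[k] γ = χ ((γ 1 1 : ℤ) : ZMod N) • ⇑H)
    (h2 : ∀ n : ℕ, Valued.v (ι.symm ((qExpansion 1 (⇑H : ℍ → ℂ)).coeff n)) ≤ 1)
    (h3 : ∃ e : ℂ, Valued.v (ι.symm e) = 1 ∧ ∀ γ : SL(2, ℤ), Tendsto ((⇑H : ℍ → ℂ) ∣[k] γ) atImInfty
      (𝓝 (if (N : ℤ) ∣ γ 1 0 ∧ ¬ (M : ℤ) ∣ γ 1 0 then e * χ ((γ 1 1 : ℤ) : ZMod N) else 0))) :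
    ∃ H' : ModularForm (Gamma1 (N * M)) k,
      (∀ γ : SL(2, ℤ), γ ∈ Gamma0 (N * M) →
        (⇑H' : ℍ → ℂ) ∣[k] γ = χ ((γ 1 1 : ℤ) : ZMod N) • ⇑H') ∧
      (∀ n : ℕ, Valued.v (ι.symm ((qExpansion 1 (⇑H' : ℍ → ℂ)).coeff n)) ≤ 1) ∧
      (∃ e : ℂ, Valued.v (ι.symm e) = 1 ∧ ∀ γ : SL(2, ℤ), Tendsto ((⇑H' : ℍ → ℂ) ∣[k] γ) atImInfty
        (𝓝 (if (N : ℤ) ∣ γ 1 0 ∧ ¬ (M : ℤ) ∣ γ 1 0 then e * χ ((γ 1 1 : ℤ) : ZMod N) else 0))) := by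
  haveI : NeZero M := ⟨hM.out.ne_zero⟩
  have hpM : ¬ p ∣ M := fun h ↦ hMp ((Nat.prime_dvd_prime_iff_eq Fact.out hM.out).mp h).symm
  induction s, hs using Nat.le_induction with
  | base =>
    refine ⟨restrictGamma1 (by rw [pow_one]) H, fun γ hγ ↦ h1 γ (by rw [pow_one]; exact hγ), h2, h3⟩
  | succ s hs ih =>
    set Hr : ModularForm (Gamma1 (N * M ^ s * M)) k :=
      restrictGamma1 (by rw [pow_succ, mul_assoc]) H with hHr
    have hlev : N * M ^ s * M = N * M ^ (s + 1) := by rw [pow_succ, mul_assoc]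
    have hf : ∀ γ : SL(2, ℤ), γ ∈ Gamma0 (N * M ^ s * M) →
        (⇑Hr : ℍ → ℂ) ∣[k] γ = χ ((γ 1 1 : ℤ) : ZMod N) • ⇑Hr := by
      intro γ hγ
      rw [hlev] at hγ
      exact h1 γ hγ
    have hML : M ∣ N * M ^ s := dvd_mul_of_dvd_right (dvd_pow_self M (by omega)) N
    have hNL : N ∣ N * M ^ s := dvd_mul_right N _
    refine ih (uLower hM.out hML hNL χ Hr hf) (fun γ hγ ↦ uLower_slash_of_mem_gamma0 hM.out hML hNL χ Hr hf hγ)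
      (fun n ↦ ?_) ?_
    · rw [qExpansion_coeff_uLower]
      exact h2 (M * n)
    · obtain ⟨e, he, hct⟩ := h3
      refine ⟨(M : ℂ) ^ (k - 1) * χ (M : ZMod N) * e, ?_, fun γ ↦ ?_⟩
      · have hMu : IsUnit ((M : ZMod N)) := (ZMod.isUnit_iff_coprime M N).mpr hMN
        obtain ⟨uM, huM⟩ := hMu
        have hχM : Valued.v (ι.symm (χ (M : ZMod N))) = 1 := by
          rw [← huM]; exact valuation_symm_apply_unit_eq_one ι χ uM
        have hMv : Valued.v (ι.symm ((M : ℂ) ^ (k - 1))) = 1 := by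
          rw [map_zpow₀, map_zpow₀, valuation_symm_natCast_eq_one ι hpM, _root_.one_zpow]
        simp only [map_mul, he, hχM, hMv, mul_one]
      · exact tendsto_uLower_slash_atImInfty hM.out hML hNL χ Hr hf e hct γ

end Descend

/-! ### Bernoulli numbers of characters that agree as functions on `ℕ` -/

section Bernoulli

/-- `changeLevel` does not change the values on naturals when the two levels have the same prime
divisors. [folklore] -/
theorem changeLevel_apply_natCast_of_primes {n n' : ℕ} [NeZero n'] (h : n ∣ n')
    (hprimes : ∀ ℓ : ℕ, ℓ.Prime → ℓ ∣ n' → ℓ ∣ n) (χ : DirichletCharacter ℂ n) (a : ℕ) :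
    DirichletCharacter.changeLevel h χ (a : ZMod n') = χ a := by
  by_cases ha : IsUnit (a : ZMod n')
  · obtain ⟨w, hw⟩ := ha
    rw [← hw, DirichletCharacter.changeLevel_eq_cast_of_dvd χ h, hw, ZMod.cast_natCast h]
  · rw [MulChar.map_nonunit _ ha]
    have ha' : ¬ a.Coprime n' := by rwa [← ZMod.isUnit_iff_coprime]
    obtain ⟨ℓ, hℓ, hℓa, hℓn⟩ := Nat.Prime.not_coprime_iff_dvd.mp ha'
    have : ¬ IsUnit (a : ZMod n) := by
      rw [ZMod.isUnit_iff_coprime]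
      exact fun hcop ↦ hℓ.one_lt.ne' (Nat.eq_one_of_dvd_coprimes hcop hℓa (hprimes ℓ hℓ hℓn))
    rw [MulChar.map_nonunit _ this]

/-- **`B_{k,χ₁} = B_{k,χ₂}` for characters agreeing on `ℕ` whose levels have the same prime
divisors** (both equal the Bernoulli number of the common character modulo `n₁n₂`).
[cite: Washington1997, §4.1] -/
theorem generalizedBernoulli_eq_of_apply_natCast_eq {n₁ n₂ : ℕ} [NeZero n₁] [NeZero n₂]
    (χ₁ : DirichletCharacter ℂ n₁) (χ₂ : DirichletCharacter ℂ n₂)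
    (hprimes : ∀ ℓ : ℕ, ℓ.Prime → (ℓ ∣ n₁ ↔ ℓ ∣ n₂)) (h : ∀ a : ℕ, χ₁ a = χ₂ a) (m : ℕ) :
    generalizedBernoulli m χ₁ = generalizedBernoulli m χ₂ := by
  haveI : NeZero (n₁ * n₂) := ⟨mul_ne_zero (NeZero.ne n₁) (NeZero.ne n₂)⟩
  have hp1 : ∀ ℓ : ℕ, ℓ.Prime → ℓ ∣ n₁ * n₂ → ℓ ∣ n₁ := fun ℓ hℓ hd ↦
    ((Nat.Prime.dvd_mul hℓ).mp hd).elim id (hprimes ℓ hℓ).mpr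
  have hp2 : ∀ ℓ : ℕ, ℓ.Prime → ℓ ∣ n₁ * n₂ → ℓ ∣ n₂ := fun ℓ hℓ hd ↦
    ((Nat.Prime.dvd_mul hℓ).mp hd).elim (hprimes ℓ hℓ).mp id
  rw [← generalizedBernoulli_changeLevel (dvd_mul_right n₁ n₂) hp1 χ₁ m,
    ← generalizedBernoulli_changeLevel (dvd_mul_left n₂ n₁) hp2 χ₂ m]
  congr 1
  refine MulChar.ext' fun x ↦ ?_
  rw [← ZMod.natCast_zmod_val x, changeLevel_apply_natCast_of_primes _ hp1,
    changeLevel_apply_natCast_of_primes _ hp2, h]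

end Bernoulli

/-! ### The cuspidal congruence for `k ≥ 4` -/

section Final

variable {p : ℕ} [Fact p.Prime]

/-- `changeLevel χ (a) · ψ'(a) = χ(a) ψ'(a)` for `χ` modulo `N`, levels `N M` and `M^r` (`r ≥ 1`):
the two sides vanish together at the multiples of `M`. [folklore] -/
theorem changeLevel_apply_natCast_mul {N : ℕ} [NeZero N] (χ : DirichletCharacter ℂ N) {M : ℕ}
    [hM : Fact M.Prime] {r : ℕ} (hr : 1 ≤ r) (ψ' : DirichletCharacter ℂ (M ^ r)) (a : ℕ) :
    DirichletCharacter.changeLevel (dvd_mul_right N M) χ (a : ZMod (N * M)) * ψ' (a : ZMod (M ^ r)) =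
      χ a * ψ' a := by
  haveI : NeZero M := ⟨hM.out.ne_zero⟩
  by_cases hMa : M ∣ a
  · have : ¬ IsUnit (a : ZMod (M ^ r)) := by
      rw [ZMod.isUnit_iff_coprime]
      intro hcop
      have := Nat.Coprime.coprime_dvd_right (dvd_pow_self M (by omega)) hcop
      exact hM.out.one_lt.ne' (Nat.eq_one_of_dvd_coprimes this hMa dvd_rfl)
    rw [MulChar.map_nonunit ψ' this, mul_zero, mul_zero]
  · congr 1
    by_cases ha : IsUnit (a : ZMod (N * M))
    · obtain ⟨w, hw⟩ := ha
      rw [← hw, DirichletCharacter.changeLevel_eq_cast_of_dvd χ, hw, ZMod.cast_natCast (dvd_mul_right N M)]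
    · rw [MulChar.map_nonunit _ ha]
      have ha' : ¬ a.Coprime (N * M) := by rwa [← ZMod.isUnit_iff_coprime]
      obtain ⟨ℓ, hℓ, hℓa, hℓn⟩ := Nat.Prime.not_coprime_iff_dvd.mp ha'
      have hℓN : ℓ ∣ N := by
        rcases (Nat.Prime.dvd_mul hℓ).mp hℓn with h | h
        · exact h
        · exfalso; exact hMa (((Nat.prime_dvd_prime_iff_eq hℓ hM.out).mp h) ▸ hℓa)
      have : ¬ IsUnit (a : ZMod N) := by
        rw [ZMod.isUnit_iff_coprime]
        exact fun hcop ↦ hℓ.one_lt.ne' (Nat.eq_one_of_dvd_coprimes hcop hℓa hℓN)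
      rw [MulChar.map_nonunit _ this]

/-- `𝟙_M(a) ψ'(a) = ψ'(a)` for `ψ'` modulo `M^r`, `r ≥ 1`. [folklore] -/
theorem one_apply_natCast_mul_eq {M : ℕ} [hM : Fact M.Prime] {r : ℕ} (hr : 1 ≤ r)
    (ψ' : DirichletCharacter ℂ (M ^ r)) (a : ℕ) :
    (1 : DirichletCharacter ℂ M) (a : ZMod M) * ψ' (a : ZMod (M ^ r)) = ψ' a := by
  haveI : NeZero M := ⟨hM.out.ne_zero⟩
  by_cases hMa : M ∣ a
  · have : ¬ IsUnit (a : ZMod (M ^ r)) := by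
      rw [ZMod.isUnit_iff_coprime]
      intro hcop
      have := Nat.Coprime.coprime_dvd_right (dvd_pow_self M (by omega)) hcop
      exact hM.out.one_lt.ne' (Nat.eq_one_of_dvd_coprimes this hMa dvd_rfl)
    rw [MulChar.map_nonunit ψ' this, mul_zero]
  · have hu : IsUnit (a : ZMod M) := by
      rw [ZMod.isUnit_iff_coprime]
      exact (Nat.Prime.coprime_iff_not_dvd hM.out).mpr hMa |>.symm
    rw [MulChar.one_apply hu, one_mul]

/-- Same prime divisors: `M^r N` and `N M M^r` (`r ≥ 1`), resp. `M^r` and `M M^r`. [folklore] -/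
theorem prime_dvd_iff_aux {N M r ℓ : ℕ} (hM : M.Prime) (hr : 1 ≤ r) (hℓ : ℓ.Prime) :
    (ℓ ∣ M ^ r * N ↔ ℓ ∣ N * M * M ^ r) ∧ (ℓ ∣ M ^ r * 1 ↔ ℓ ∣ M * M ^ r) := by
  have hMr : ℓ ∣ M ^ r ↔ ℓ = M := by
    constructor
    · intro h; exact (Nat.prime_dvd_prime_iff_eq hℓ hM).mp (hℓ.dvd_of_dvd_pow h)
    · rintro rfl; exact dvd_pow_self _ (by omega)
  have hM' : ℓ ∣ M ↔ ℓ = M := Nat.prime_dvd_prime_iff_eq hℓ hM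
  simp only [Nat.Prime.dvd_mul hℓ, hMr, hM', mul_one]
  tauto

open Sinnott1987 in
/-- **Washington's theorem applied twice: a second-kind character with two Bernoulli units.**
For `M ≠ p` prime, `p ≠ 2`, `χ` modulo `N`, and weights `n₁, n₂ ≥ 1` with
`χ(-1) = (-1)^{n₁}` and `n₂` even, there are `r ≥ 1` and a primitive even character `ψ` modulo
`M^r` with `B_{n₁,(ψχ̄)⁻¹}/n₁` and `B_{n₂,ψ}/n₂` (in the `changeLevel` normal forms used by the
two-character Eisenstein series) `p`-adic units. [cite: Washington1978, Theorem] [cite: Sinnott1987, §4.5] -/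
theorem exists_secondKind_two_units (ι : PadicAlgCl p ≃+* ℂ) {N : ℕ} [NeZero N]
    (χ : DirichletCharacter ℂ N) {M : ℕ} [hM : Fact M.Prime]
    (hMp : M ≠ p) (hp2 : p ≠ 2) {n₁ n₂ : ℕ} (hn₁ : 1 ≤ n₁) (hn₂ : 1 ≤ n₂)
    (hpar₁ : χ (-1) = (-1) ^ n₁) (hpar₂ : Even n₂) :
    ∃ r : ℕ, 1 ≤ r ∧ ∃ ψ : DirichletCharacter ℂ (M ^ r), ψ.IsPrimitive ∧ ψ (-1) = 1 ∧
      Valued.v (ι.symm (generalizedBernoulli n₁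
        (DirichletCharacter.changeLevel (dvd_mul_right (M ^ r) N) ψ *
          DirichletCharacter.changeLevel (dvd_mul_left N (M ^ r)) χ⁻¹)⁻¹ / n₁)) = 1 ∧
      Valued.v (ι.symm (generalizedBernoulli n₂
        (DirichletCharacter.changeLevel (dvd_mul_right (M ^ r) 1) ψ⁻¹ *
          DirichletCharacter.changeLevel (dvd_mul_left 1 (M ^ r))
            (1 : DirichletCharacter ℂ 1)⁻¹)⁻¹ / n₂)) = 1 := by
  have hM' := hM.out
  haveI : NeZero M := ⟨hM'.ne_zero⟩
  have hp : p.Prime := Fact.out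
  -- ### the valuation `v₀ = v_p ∘ ι⁻¹` on `ℂ`
  set v₀ : Valuation ℂ ℝ≥0 := (Valued.v (R := PadicAlgCl p)).comap ι.symm.toRingHom with hv₀def
  have hv₀ : ∀ x, v₀ x = Valued.v (ι.symm x) := fun x ↦ rfl
  have hvp : v₀ (p : ℂ) < 1 := by
    rw [hv₀, map_natCast, PadicAlgCl.valuation_p, one_div]
    exact inv_lt_one_of_one_lt₀ (by exact_mod_cast hp.one_lt)
  have hroots : ∀ m : ℕ, 0 < m → ∃ ζ : ℂ, IsPrimitiveRoot ζ m := fun m hm ↦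
    ⟨_, Complex.isPrimitiveRoot_exp m hm.ne'⟩
  -- ### Washington's theorem, twice
  set θA := DirichletCharacter.changeLevel (dvd_mul_right N M) χ with hθA
  have hparA : θA (-1) = (-1) ^ n₁ := by
    have hu : ((-1 : (ZMod (N * M))ˣ) : ZMod (N * M)) = -1 := by simp
    rw [hθA, ← hu, DirichletCharacter.changeLevel_eq_cast_of_dvd χ (dvd_mul_right N M)]
    simp only [Units.val_neg, Units.val_one]
    rw [ZMod.cast_neg (dvd_mul_right N M), ZMod.cast_one (dvd_mul_right N M), hpar₁]
  obtain ⟨rA, hrA⟩ := washington_sinnott_valuation_eq_one v₀ hvp hMp hp2 hroots (f := N * M)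
    (dvd_mul_left M N) θA (n := n₁) hn₁ hparA
  have hparB : (1 : DirichletCharacter ℂ M) (-1) = (-1) ^ n₂ := by
    rw [MulChar.one_apply (isUnit_one.neg), hpar₂.neg_one_pow]
  obtain ⟨rB, hrB⟩ := washington_sinnott_valuation_eq_one v₀ hvp hMp hp2 hroots (f := M) dvd_rfl
    (1 : DirichletCharacter ℂ M) (n := n₂) hn₂ hparB
  -- ### the conductor exponent `r` and the second-kind character `ψ`
  set r : ℕ := max (max rA rB) (depth M + 1) with hrdef
  have hrd : depth M < r := by omega
  have hr1 : 1 ≤ r := le_trans (one_le_depth M) hrd.le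
  obtain ⟨ψ, hψprim, hψV, hψker⟩ := exists_secondKind_complex (M := M) (m := r) hrd
  have hψ1 : ψ (-1) = 1 := by
    have := hψV (-1) isTors_neg_one
    simpa using this
  have hψinvV : ∀ u : (ZMod (M ^ r))ˣ, IsTors u → ψ⁻¹ u = 1 := fun u hu ↦ by
    rw [MulChar.inv_apply_eq_inv', hψV u hu, inv_one]
  have hψinvker : ∀ u : (ZMod (M ^ r))ˣ, ψ⁻¹ u = 1 → IsTors u := fun u hu ↦ by
    rw [MulChar.inv_apply_eq_inv', inv_eq_one] at hu
    exact hψker u hu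
  -- ### the two Bernoulli units
  have hWA := hrA r (by omega) ψ hψprim hψV hψker
  have hWB := hrB r (by omega) ψ⁻¹ (Literature.NumberTheory.LFunctions.isPrimitive_inv ψ hψprim)
    hψinvV hψinvker
  rw [hv₀] at hWA hWB
  refine ⟨r, hr1, ψ, hψprim, hψ1, ?_, ?_⟩
  · rw [← hWA]
    congr 3
    refine generalizedBernoulli_eq_of_apply_natCast_eq _ _
      (fun ℓ hℓ ↦ (prime_dvd_iff_aux hM' hr1 hℓ).1) (fun a ↦ ?_) _
    rw [MulChar.inv_apply_eq_inv', changeLevel_mul_changeLevel_inv_apply_natCast ψ χ a,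
      changeLevel_mul_changeLevel_inv_apply_natCast θA ψ a, hθA,
      changeLevel_apply_natCast_mul χ hr1 ψ⁻¹ a, MulChar.inv_apply_eq_inv' χ,
      MulChar.inv_apply_eq_inv' ψ, mul_inv, inv_inv, mul_comm]
  · rw [← hWB]
    congr 3
    refine generalizedBernoulli_eq_of_apply_natCast_eq _ _
      (fun ℓ hℓ ↦ (prime_dvd_iff_aux (N := N) hM' hr1 hℓ).2) (fun a ↦ ?_) _
    rw [MulChar.inv_apply_eq_inv',
      changeLevel_mul_changeLevel_inv_apply_natCast ψ⁻¹ (1 : DirichletCharacter ℂ 1) a,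
      changeLevel_mul_changeLevel_inv_apply_natCast (1 : DirichletCharacter ℂ M) ψ⁻¹ a,
      inv_one, MulChar.one_apply (isUnit_of_subsingleton _), mul_one, inv_inv,
      MulChar.inv_apply_eq_inv', inv_inv, one_apply_natCast_mul_eq hr1 ψ a]

/-- Values of `ψ̄` at `N` are `p`-adic units (`M ∤ N`). [folklore] -/
theorem valuation_inv_apply_level_eq_one (ι : PadicAlgCl p ≃+* ℂ) {N M r : ℕ} [Fact M.Prime]
    (hMN : M.Coprime N) (ψ : DirichletCharacter ℂ (M ^ r)) :
    Valued.v (ι.symm (ψ⁻¹ (N : ZMod (M ^ r)))) = 1 := by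
  obtain ⟨uN, huN⟩ := isUnit_natCast_level (r := r) hMN
  rw [← huN]
  exact valuation_symm_apply_unit_eq_one ι ψ⁻¹ uN

/-- **The cuspidal congruence `hC` for `k ≥ 5`, unconditionally** (product `E_{k-2}^{ψ,χ}·S_2^{ψ̄,𝟙}/c`,
Washington's theorem via Sinnott, `U_M`-descent, `CuspFormLift`).
[cite: BillereyMenares2016, §2, proof of Thm. 2.2 (p. 7)] [cite: Washington1978, Theorem]
[cite: Sinnott1987, §4.5] -/
theorem cuspidalCongruence_of_five_le (ι : PadicAlgCl p ≃+* ℂ) {N : ℕ} [NeZero N]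
    (χ : DirichletCharacter ℂ N) (k : ℕ) (hk : 3 ≤ k) (M : ℕ) [NeZero M] (hp5 : 5 ≤ p)
    (hχ : χ.IsPrimitive) (hpar : χ (-1) = (-1) ^ k) (hpN : ¬ p ∣ N) (hM : M.Prime) (hMN : ¬ M ∣ N)
    (hMp : M ≠ p) (hk5 : 5 ≤ k)
    (hcusp : ∀ γ : SL(2, ℤ), ∃ c : ℂ,
      Tendsto ((⇑(eisensteinLevelRaised N k χ M hk) : ℍ → ℂ) ∣[(k : ℤ)] γ) atImInfty (𝓝 c) ∧
        Valued.v (ι.symm c) < 1) :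
    ∃ f₀ : CuspForm (Gamma1 (N * M)) k,
      f₀ ∈ nebentypusSubspace (N * M) k (DirichletCharacter.changeLevel (dvd_mul_right N M) χ) ∧
      ∀ n, Valued.v (ι.symm (cuspCoeff f₀ n -
        (qExpansion 1 ⇑(eisensteinLevelRaised N k χ M hk)).coeff n)) < 1 := by
  haveI hMf : Fact M.Prime := ⟨hM⟩
  have hMN' : M.Coprime N := (Nat.Prime.coprime_iff_not_dvd hM).2 hMN
  have hp2 : p ≠ 2 := by omega
  have hpM : ¬ p ∣ M := fun h ↦ hMp ((Nat.prime_dvd_prime_iff_eq Fact.out hM).mp h).symm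
  obtain ⟨r, hr1, ψ, hψprim, hψ1, hBA, hBB⟩ := exists_secondKind_two_units ι χ hMp hp2
    (n₁ := k - 2) (n₂ := 2) (by omega) (by norm_num)
    (by rw [hpar, neg_one_pow_eq_pow_sub_two k hk5]) even_two
  -- ### the unit `e = 2 e₂ ψ̄(N)`
  have hu2 : Valued.v (ι.symm (2 : ℂ)) = 1 := by
    have := valuation_symm_natCast_eq_one ι (n := 2) (fun h ↦ hp2
      ((Nat.prime_dvd_prime_iff_eq Fact.out Nat.prime_two).mp h))
    simpa using this
  have hpMr : ¬ p ∣ M ^ r := fun h ↦ hpM (Nat.Prime.dvd_of_dvd_pow Fact.out h)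
  have he₂ : Valued.v (ι.symm (twoCharTwoUnit ψ⁻¹ (1 : DirichletCharacter ℂ 1))) = 1 :=
    valuation_twoCharTwoUnit_eq_one ψ⁻¹ (1 : DirichletCharacter ℂ 1) ι
      (Literature.NumberTheory.LFunctions.isPrimitive_inv ψ hψprim)
      DirichletCharacter.isPrimitive_one_level_one (Nat.coprime_one_right _) hpMr
      (Nat.Prime.not_dvd_one Fact.out) hp2 (by simpa using hBB)
  have he : Valued.v (ι.symm (2 * twoCharTwoUnit ψ⁻¹ (1 : DirichletCharacter ℂ 1) *
      ψ⁻¹ (N : ZMod (M ^ r)))) = 1 := by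
    simp only [map_mul, hu2, he₂, valuation_inv_apply_level_eq_one ι hMN' ψ, one_mul]
  -- ### the product form and the descent
  obtain ⟨H, hH1, hH2, e, he', hH3⟩ := WashingtonLift.descend ι χ hMN' hMp (k : ℤ) r hr1
    (prodFormA χ ψ k hk5)
    (fun γ hγ ↦ prodFormA_slash_of_mem_gamma0 χ ψ k hk5 hγ)
    (valuation_qExpansion_coeff_prodFormA_le_one χ ψ k ι hk5 hr1 hψprim hχ hMN' hpar hψ1 hpN hBA)
    ⟨_, he, tendsto_prodFormA_slash_atImInfty χ ψ k hk5 hr1 hMN' hψprim hpar hψ1⟩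
  exact CuspFormLift.exists_cuspForm_nebentypus_congr_of_integralForm ι χ k hk M hM hMN hcusp H
    hH1 hH2 e he' hH3

/-- **The cuspidal congruence `hC` for `k = 4`, unconditionally** (product
`S_2^{ψ,χ}/c' · S_2^{ψ̄,𝟙}/c`). [cite: BillereyMenares2016, §2, proof of Thm. 2.2 (p. 7)]
[cite: Washington1978, Theorem] [cite: Sinnott1987, §4.5] -/
theorem cuspidalCongruence_four (ι : PadicAlgCl p ≃+* ℂ) {N : ℕ} [NeZero N]
    (χ : DirichletCharacter ℂ N) (hk : 3 ≤ 4) (M : ℕ) [NeZero M] (hp5 : 5 ≤ p)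
    (hχ : χ.IsPrimitive) (hpar : χ (-1) = (-1) ^ 4) (hpN : ¬ p ∣ N) (hM : M.Prime) (hMN : ¬ M ∣ N)
    (hMp : M ≠ p)
    (hcusp : ∀ γ : SL(2, ℤ), ∃ c : ℂ,
      Tendsto ((⇑(eisensteinLevelRaised N 4 χ M hk) : ℍ → ℂ) ∣[((4 : ℕ) : ℤ)] γ) atImInfty (𝓝 c) ∧
        Valued.v (ι.symm c) < 1) :
    ∃ f₀ : CuspForm (Gamma1 (N * M)) (4 : ℕ),
      f₀ ∈ nebentypusSubspace (N * M) (4 : ℕ) (DirichletCharacter.changeLevel (dvd_mul_right N M) χ) ∧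
      ∀ n, Valued.v (ι.symm (cuspCoeff f₀ n -
        (qExpansion 1 ⇑(eisensteinLevelRaised N 4 χ M hk)).coeff n)) < 1 := by
  haveI hMf : Fact M.Prime := ⟨hM⟩
  have hMN' : M.Coprime N := (Nat.Prime.coprime_iff_not_dvd hM).2 hMN
  have hp2 : p ≠ 2 := by omega
  have hpM : ¬ p ∣ M := fun h ↦ hMp ((Nat.prime_dvd_prime_iff_eq Fact.out hM).mp h).symm
  have hχ1 : χ (-1) = 1 := by rw [hpar]; norm_num
  obtain ⟨r, hr1, ψ, hψprim, hψ1, hBA, hBB⟩ := exists_secondKind_two_units ι χ hMp hp2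
    (n₁ := 2) (n₂ := 2) (by norm_num) (by norm_num) (by rw [hχ1]; norm_num) even_two
  have hpMr : ¬ p ∣ M ^ r := fun h ↦ hpM (Nat.Prime.dvd_of_dvd_pow Fact.out h)
  have he₂ : Valued.v (ι.symm (twoCharTwoUnit ψ⁻¹ (1 : DirichletCharacter ℂ 1))) = 1 :=
    valuation_twoCharTwoUnit_eq_one ψ⁻¹ (1 : DirichletCharacter ℂ 1) ι
      (Literature.NumberTheory.LFunctions.isPrimitive_inv ψ hψprim)
      DirichletCharacter.isPrimitive_one_level_one (Nat.coprime_one_right _) hpMr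
      (Nat.Prime.not_dvd_one Fact.out) hp2 (by simpa using hBB)
  have he₂' : Valued.v (ι.symm (twoCharTwoUnit ψ χ)) = 1 :=
    valuation_twoCharTwoUnit_eq_one ψ χ ι hψprim hχ (Nat.Coprime.pow_left r hMN') hpMr hpN hp2
      (by simpa using hBA)
  have he : Valued.v (ι.symm (twoCharTwoUnit ψ χ * twoCharTwoUnit ψ⁻¹ (1 : DirichletCharacter ℂ 1) *
      ψ⁻¹ (N : ZMod (M ^ r)))) = 1 := by
    simp only [map_mul, he₂, he₂', valuation_inv_apply_level_eq_one ι hMN' ψ, one_mul]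
  obtain ⟨H, hH1, hH2, e, he', hH3⟩ := WashingtonLift.descend ι χ hMN' hMp ((4 : ℕ) : ℤ) r hr1
    (prodFormB χ ψ)
    (fun γ hγ ↦ prodFormB_slash_of_mem_gamma0 χ ψ hγ)
    (valuation_qExpansion_coeff_prodFormB_le_one χ ψ ι hr1 hψprim hχ hχ1 hψ1)
    ⟨_, he, tendsto_prodFormB_slash_atImInfty χ ψ hr1 hMN' hψprim hχ hχ1 hψ1⟩
  exact CuspFormLift.exists_cuspForm_nebentypus_congr_of_integralForm ι χ 4 hk M hM hMN hcusp H
    hH1 hH2 e he' hH3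

/-- **The cuspidal congruence `hC` for all `k ≥ 4`.** [cite: BillereyMenares2016, §2, proof of Thm. 2.2] -/
theorem cuspidalCongruence_of_four_le (ι : PadicAlgCl p ≃+* ℂ) {N : ℕ} [NeZero N]
    (χ : DirichletCharacter ℂ N) (k : ℕ) (hk : 3 ≤ k) (M : ℕ) [NeZero M] (hp5 : 5 ≤ p)
    (hχ : χ.IsPrimitive) (hpar : χ (-1) = (-1) ^ k) (hpN : ¬ p ∣ N) (hM : M.Prime) (hMN : ¬ M ∣ N)
    (hMp : M ≠ p) (hk4 : 4 ≤ k)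
    (hcusp : ∀ γ : SL(2, ℤ), ∃ c : ℂ,
      Tendsto ((⇑(eisensteinLevelRaised N k χ M hk) : ℍ → ℂ) ∣[(k : ℤ)] γ) atImInfty (𝓝 c) ∧
        Valued.v (ι.symm c) < 1) :
    ∃ f₀ : CuspForm (Gamma1 (N * M)) k,
      f₀ ∈ nebentypusSubspace (N * M) k (DirichletCharacter.changeLevel (dvd_mul_right N M) χ) ∧
      ∀ n, Valued.v (ι.symm (cuspCoeff f₀ n -
        (qExpansion 1 ⇑(eisensteinLevelRaised N k χ M hk)).coeff n)) < 1 := by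
  rcases Nat.lt_or_ge k 5 with h | h
  · obtain rfl : k = 4 := by omega
    exact cuspidalCongruence_four ι χ hk M hp5 hχ hpar hpN hM hMN hMp hcusp
  · exact cuspidalCongruence_of_five_le ι χ k hk M hp5 hχ hpar hpN hM hMN hMp h hcusp

end Final

end WashingtonLift

end Literature.NumberTheory.EllipticCurves.ModularForms
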